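import Summits.NavierStokesRegularity.NavierStokesRegularity.Theorems.MeridionalBarrier
import Literature.Analysis.FluidPDE.NSLerayHopfSereginMild
import HarnessLib

/-!
# ROUND-17 (nsreg-p2, gen 19) — `MeridionalBarrier`, part 2: the Navier–Stokes frame — the
# meridional Péclet gauge and the factorisation of ROUND-16

Second half of planner nsreg-p2's companion `R17-MeridionalBarrier.lean` (sha16 f416b442f0c19a15),
split for the 400-line rule; see the module docstring of `…Theorems.MeridionalBarrier` (§1: the
steady homogeneous class — meridional Péclet potential, trap depth, Arrhenius laws) for the
mechanism, the kit evidence (j276123, j276293) and the sources.  Contents (§2): the junk-free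
`northwardMoment` / Péclet densities / `shellWindow` / `northwardPeclet`, `southwardPeclet`,
`meridionalPeclet` (in `ℝ≥0∞`); the LINEAR-TYPE rung `MeridionalGaugedHolderLaw γ₃` /
`MeridionalGaugedLaw` / `ArrheniusMeridionalLaw`; the NAVIER–STOKES-ESSENTIAL rung
`MeridionalSwirlLaw κ` / `MeridionalSwirlBudget`; and the PROVED factorisation
`swirlGaugedHolderLaw_of_meridional`, `swirlGaugedLaw_of_meridional`, `swirlGaugedLaw_of_rungs :
MeridionalSwirlBudget → MeridionalGaugedLaw → SwirlGaugedLaw` (ROUND-16's rung),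
`expSwirlProfile_of_linear_budget`.  (The companion's `parabolicCylinder_mono` is the tree's
`Literature.Analysis.FluidPDE.parabolicCylinder_subset_of_le`, used instead — gate dedup rule.)
hard core evaded: all eight — §2 presupposes the energy gauge `M < ∞` (settled regime) and
decides none of them; no NS regularity statement is asserted.
-/

namespace Summit.NavierStokesRegularity.NavierStokesRegularity.Theorems.MeridionalBarrier

open MeasureTheory Set Filter Topology Metric WithLp
open scoped ENNReal NNReal
open Literature.Analysis Literature.Analysis.FluidPDE
open Summit.NavierStokesRegularity.NavierStokesRegularity.Theorems.SwirlGaugedTower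
  (TwoGaugeHolderLaw SwirlGaugedHolderLaw SwirlGaugedLaw)
open Summit.NavierStokesRegularity.NavierStokesRegularity.Theorems.SelfSimilarEtaBudget
  (IsPassiveExponent ssGroundExponent)

noncomputable section

/-! ## 2. The Navier–Stokes frame: the meridional Péclet gauge and the factorisation of ROUND-16 -/

/-- The NORTHWARD MERIDIONAL MOMENT of the field `v` about the axis point `x₀`:
`r·(-ϱ v_ϑ) = r² v_z - y₂ (y₀ v₀ + y₁ v₁)`, `y = x - x₀`, `r = cylRadius y`, `ϱ = ‖y‖` — a
junk-free polynomial in the coordinates (positive where the fluid moves toward the "north pole"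
direction `+e_z` along spheres centred at `x₀`). -/
def northwardMoment (v : EuclideanSpace ℝ (Fin 3) → EuclideanSpace ℝ (Fin 3))
    (x₀ x : EuclideanSpace ℝ (Fin 3)) : ℝ :=
  cylRadius (x - x₀) ^ 2 * v x 2 - (x - x₀) 2 * ((x - x₀) 0 * v x 0 + (x - x₀) 1 * v x 1)

/-- Northward Péclet density `(-ϱ v_ϑ)₊ / (ϱ² sin ϑ) = (r·(-ϱv_ϑ))₊ / (ϱ r²)`: its integral over a
spherical shell is `2π ∫dϱ ∫ (-ϱ v_ϑ)₊ dϑ`, the northward meridional Péclet per sphere. -/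
def northwardDensity (v : EuclideanSpace ℝ (Fin 3) → EuclideanSpace ℝ (Fin 3))
    (x₀ x : EuclideanSpace ℝ (Fin 3)) : ℝ :=
  max (northwardMoment v x₀ x) 0 / (‖x - x₀‖ * cylRadius (x - x₀) ^ 2)

/-- Southward Péclet density (the negative part of the northward moment). -/
def southwardDensity (v : EuclideanSpace ℝ (Fin 3) → EuclideanSpace ℝ (Fin 3))
    (x₀ x : EuclideanSpace ℝ (Fin 3)) : ℝ :=
  max (-northwardMoment v x₀ x) 0 / (‖x - x₀‖ * cylRadius (x - x₀) ^ 2)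

/-- The space-time SHELL WINDOW of scale `ρ` at `z = (t₀, x₀)`: `(t₀ - ρ², t₀) × {ρ/2 < |x - x₀| < ρ}`. -/
def shellWindow (ρ : ℝ) (z : ℝ × EuclideanSpace ℝ (Fin 3)) : Set (ℝ × EuclideanSpace ℝ (Fin 3)) :=
  Ioo (z.1 - ρ ^ 2) z.1 ×ˢ {x | ρ / 2 < dist x z.2 ∧ dist x z.2 < ρ}

/-- Scale-invariant NORTHWARD MERIDIONAL PÉCLET of `u` at scale `ρ` about `z` (`ν = 1`):
`ρ^{-3} ∫_{shell window} (northward density)`, in `ℝ≥0∞` so that a non-integrable meridional flow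
cannot satisfy a bound vacuously.  On a steady `(-1)`-homogeneous flow with profile `q` it equals
`π ∫ (Φ')₊ dc`. -/
def northwardPeclet (ρ : ℝ) (z : ℝ × EuclideanSpace ℝ (Fin 3))
    (u : ℝ → EuclideanSpace ℝ (Fin 3) → EuclideanSpace ℝ (Fin 3)) : ℝ≥0∞ :=
  (ENNReal.ofReal ρ ^ 3)⁻¹ * ∫⁻ q in shellWindow ρ z, ENNReal.ofReal (northwardDensity (u q.1) z.2 q.2)

/-- Scale-invariant SOUTHWARD MERIDIONAL PÉCLET (as `northwardPeclet`, with the southward density). -/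
def southwardPeclet (ρ : ℝ) (z : ℝ × EuclideanSpace ℝ (Fin 3))
    (u : ℝ → EuclideanSpace ℝ (Fin 3) → EuclideanSpace ℝ (Fin 3)) : ℝ≥0∞ :=
  (ENNReal.ofReal ρ ^ 3)⁻¹ * ∫⁻ q in shellWindow ρ z, ENNReal.ofReal (southwardDensity (u q.1) z.2 q.2)

/-- **THE MERIDIONAL PÉCLET GAUGE** `min(northward, southward)`: trapping away from the axis needs
BOTH a northward and a southward branch.  An unordered upper envelope of `π·B[q]` on steady
homogeneous flows (`π N/4` on the funnel; it overcharges convergence cells such as the reversed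
funnel, where `B = 0`, and never undercharges) — the ordered trap depth needs meridian restrictions,
which are not representative-independent for weak solutions. -/
def meridionalPeclet (ρ : ℝ) (z : ℝ × EuclideanSpace ℝ (Fin 3))
    (u : ℝ → EuclideanSpace ℝ (Fin 3) → EuclideanSpace ℝ (Fin 3)) : ℝ≥0∞ :=
  min (northwardPeclet ρ z u) (southwardPeclet ρ z u)

/-- Sanity (junk-freeness and sign convention): a RAY field `v(x) = f(x)·(x - x₀)` (pure motion along
rays from the axis point: Landau-type outflow/inflow along rays) has northward moment zero — ray
motion is neither northward nor southward. -/
theorem northwardMoment_ray (f : EuclideanSpace ℝ (Fin 3) → ℝ) (x₀ x : EuclideanSpace ℝ (Fin 3)) :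
    northwardMoment (fun y => f y • (y - x₀)) x₀ x = 0 := by
  simp only [northwardMoment, PiLp.smul_apply, smul_eq_mul, cylRadius_sq]
  ring

/-- The gauge vanishes trivially with the field. -/
theorem northwardMoment_zero (x₀ x : EuclideanSpace ℝ (Fin 3)) :
    northwardMoment (fun _ => 0) x₀ x = 0 := by
  simp [northwardMoment]

/-- **MERIDIONALLY GAUGED HÖLDER LAW with rate `γ₃`** (LINEAR-TYPE rung; multi-scale form of the
Chen–Tsai–Zhang / Ożański–Palasek frame `TwoGaugeHolderLaw`, `ν = 1`).  For every axisymmetric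
suitable weak solution in `Q(1)` with energy gauge `cknA ≤ M` at all points of `Q(1/2)` and scales
`≤ 1/4`, every axis point `z₀ ∈ Q(1/8)`, every `P ≥ 0` and every scale `ρ ≤ 1/4` below which the
meridional Péclet about `z₀` is `≤ P`: a swirl interval `[a, b]` on `Q(z₀, ρ)` contracts on `Q(z₀, r)`,
`r ≤ ρ`, to length `≤ K (1+M)^K (r/ρ)^{γ₃ P} (b - a)` — the energy gauge in the PREFACTOR only, the
meridional Péclet in the EXPONENT only.  Conjecturally true with the Arrhenius rate
`γ₃ P = c e^{-P/π}` and false with any rate decaying slower than exponentially (the funnel). -/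
def MeridionalGaugedHolderLaw (γ₃ : ℝ → ℝ) : Prop :=
  ∃ K : ℝ, 0 < K ∧ ∀ (u : ℝ → (EuclideanSpace ℝ (Fin 3)) → (EuclideanSpace ℝ (Fin 3)))
      (p : ℝ → (EuclideanSpace ℝ (Fin 3)) → ℝ),
    IsSuitableWeakSolutionInBall 1 0 u p →
    (∀ t ∈ Ioo (-1 : ℝ) 0, IsAxisymmetric (u t)) →
    (∀ t ∈ Ioo (-1 : ℝ) 0, IsAxisymmetricScalar (p t)) →
    ∀ M : ℝ, 0 ≤ M →
    (∀ z ∈ parabolicCylinder (1 / 2) (0 : ℝ × (EuclideanSpace ℝ (Fin 3))), ∀ R : ℝ, 0 < R → R ≤ 1 / 4 →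
      cknA R z u ≤ ENNReal.ofReal M) →
    ∀ z₀ ∈ parabolicCylinder (1 / 8) (0 : ℝ × (EuclideanSpace ℝ (Fin 3))), cylRadius z₀.2 = 0 →
    ∀ P : ℝ, 0 ≤ P →
    ∀ ρ : ℝ, 0 < ρ → ρ ≤ 1 / 4 →
    (∀ ρ' : ℝ, 0 < ρ' → ρ' ≤ ρ → meridionalPeclet ρ' z₀ u ≤ ENNReal.ofReal P) →
    ∀ a b : ℝ, a ≤ b →
    (∀ᵐ z ∂(volume.restrict (parabolicCylinder ρ z₀)), swirl (u z.1) z.2 ∈ Icc a b) →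
    ∀ r : ℝ, 0 < r → r ≤ ρ →
    ∃ a' b' : ℝ, a' ≤ b' ∧
      (∀ᵐ z ∂(volume.restrict (parabolicCylinder r z₀)), swirl (u z.1) z.2 ∈ Icc a' b') ∧
      b' - a' ≤ K * (1 + M) ^ K * (r / ρ) ^ (γ₃ P) * (b - a)

/-- **THE LINEAR-TYPE RUNG OF ROUND-17**: a meridionally gauged Hölder law with SOME positive rate
(normalised `≤ 1`).  Sharp form: `ArrheniusMeridionalLaw`. -/
@[conjecture]
def MeridionalGaugedLaw : Prop :=
  ∃ γ₃ : ℝ → ℝ, (∀ P : ℝ, 0 ≤ P → 0 < γ₃ P ∧ γ₃ P ≤ 1) ∧ MeridionalGaugedHolderLaw γ₃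

/-- The conjectured SHARP profile: the Arrhenius rate `γ₃ P = e^{-C(1+P)}` (the funnel forbids anything
slower; T-17.2 supports nothing faster). -/
@[conjecture]
def ArrheniusMeridionalLaw : Prop :=
  ∃ C : ℝ, 0 < C ∧ MeridionalGaugedHolderLaw (fun P => Real.exp (-(C * (1 + P))))

/-- **MERIDIONAL CIRCULATION NEEDS SWIRL** (the NAVIER–STOKES-ESSENTIAL rung, profile `κ`): in the
same frame, for every axis point `z₀ ∈ Q(1/8)` and every swirl interval `[a, b]` on `Q(z₀, 1/4)` there
is a threshold scale `ρ₁ ≥ (K(1+M)^K)^{-1}` (POLYNOMIALLY small in the energy gauge) below which the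
meridional Péclet about `z₀` is `≤ κ(b - a)` — a function of the swirl oscillation ALONE.  Heuristics:
Bjerknes (poloidal circulation about material meridional loops is forced only by `∮ Γ²/r³ dr`, else
decays), Ukhovskii–Yudovich at `b - a = 0` (`η = ω^θ/r` obeys a maximum principle, so poloidal
vorticity cannot concentrate at the axis), ROUND-16's η-budget on steady funnels (`κ(S) ≈ 0.35 S`).
FALSE for passive drifts (any `κ`): the frame's drift is the solution's own velocity. -/
@[conjecture]
def MeridionalSwirlLaw (κ : ℝ → ℝ) : Prop :=
  ∃ K : ℝ, 0 < K ∧ ∀ (u : ℝ → (EuclideanSpace ℝ (Fin 3)) → (EuclideanSpace ℝ (Fin 3)))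
      (p : ℝ → (EuclideanSpace ℝ (Fin 3)) → ℝ),
    IsSuitableWeakSolutionInBall 1 0 u p →
    (∀ t ∈ Ioo (-1 : ℝ) 0, IsAxisymmetric (u t)) →
    (∀ t ∈ Ioo (-1 : ℝ) 0, IsAxisymmetricScalar (p t)) →
    ∀ M : ℝ, 0 ≤ M →
    (∀ z ∈ parabolicCylinder (1 / 2) (0 : ℝ × (EuclideanSpace ℝ (Fin 3))), ∀ R : ℝ, 0 < R → R ≤ 1 / 4 →
      cknA R z u ≤ ENNReal.ofReal M) →
    ∀ z₀ ∈ parabolicCylinder (1 / 8) (0 : ℝ × (EuclideanSpace ℝ (Fin 3))), cylRadius z₀.2 = 0 →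
    ∀ a b : ℝ, a ≤ b →
    (∀ᵐ z ∂(volume.restrict (parabolicCylinder (1 / 4) z₀)), swirl (u z.1) z.2 ∈ Icc a b) →
    ∃ ρ₁ : ℝ, (K * (1 + M) ^ K)⁻¹ ≤ ρ₁ ∧ ρ₁ ≤ 1 / 4 ∧
      ∀ ρ' : ℝ, 0 < ρ' → ρ' ≤ ρ₁ → meridionalPeclet ρ' z₀ u ≤ ENNReal.ofReal (κ (b - a))

/-- A meridionally gauged law with a pointwise smaller (nonnegative) rate is a weaker statement. -/
theorem MeridionalGaugedHolderLaw.anti {γ γ' : ℝ → ℝ} (hle : ∀ P : ℝ, 0 ≤ P → γ P ≤ γ' P)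
    (h : MeridionalGaugedHolderLaw γ') : MeridionalGaugedHolderLaw γ := by
  obtain ⟨K, hK, hlaw⟩ := h
  refine ⟨K, hK, ?_⟩
  intro u p hsws haxi haxip M hM hA z₀ hz₀ hax P hP ρ hρ hρ4 hPe a b hab hconf r hr hrρ
  obtain ⟨a', b', ha'b', hconf', hdec⟩ :=
    hlaw u p hsws haxi haxip M hM hA z₀ hz₀ hax P hP ρ hρ hρ4 hPe a b hab hconf r hr hrρ
  refine ⟨a', b', ha'b', hconf', hdec.trans ?_⟩
  have hq1 : r / ρ ≤ 1 := (div_le_one hρ).mpr hrρ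
  have hpow : (r / ρ) ^ (γ' P) ≤ (r / ρ) ^ (γ P) :=
    Real.rpow_le_rpow_of_exponent_ge (by positivity) hq1 (hle P hP)
  have hKM : 0 ≤ K * (1 + M) ^ K := by positivity
  exact mul_le_mul_of_nonneg_right (mul_le_mul_of_nonneg_left hpow hKM) (by linarith)

/-- **THE FACTORISATION (proved).**  MERIDIONAL CIRCULATION NEEDS SWIRL (`MeridionalSwirlLaw κ`) and the
LINEAR-TYPE meridionally gauged Hölder law (`MeridionalGaugedHolderLaw γ₃`, rate normalised into
`(0, 1]`) together give ROUND-16's swirl-gauged Hölder law with profile `γ₁ = γ₃ ∘ κ`: the energy gauge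
`M` stays in the prefactor because BOTH the threshold scale and the Hölder prefactor are polynomial
in `1 + M` (scales above the threshold are paid by the prefactor, `(4r)^γ ≥ 4r > 4ρ₁`). -/
theorem swirlGaugedHolderLaw_of_meridional {κ γ₃ : ℝ → ℝ}
    (hκ : ∀ S : ℝ, 0 ≤ S → 0 ≤ κ S) (hγ : ∀ P : ℝ, 0 ≤ P → 0 < γ₃ P ∧ γ₃ P ≤ 1)
    (hN : MeridionalSwirlLaw κ) (hL : MeridionalGaugedHolderLaw γ₃) :
    SwirlGaugedHolderLaw (fun S => γ₃ (κ S)) := by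
  obtain ⟨K₁, hK₁, hN⟩ := hN
  obtain ⟨K₂, hK₂, hL⟩ := hL
  refine ⟨K₁ * K₂ + K₁ + K₂, by positivity, ?_⟩
  intro u p hsws haxi haxip M hM hA z₀ hz₀ hax a b hab hconf r hr hr4
  obtain ⟨ρ₁, hρ₁lo, hρ₁hi, hPe⟩ := hN u p hsws haxi haxip M hM hA z₀ hz₀ hax a b hab hconf
  have hS0 : 0 ≤ b - a := by linarith
  have hP0 : 0 ≤ κ (b - a) := hκ (b - a) hS0
  obtain ⟨hγpos, hγle⟩ := hγ (κ (b - a)) hP0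
  have h1M : 1 ≤ 1 + M := by linarith
  have hKM₁ : 0 < K₁ * (1 + M) ^ K₁ := by positivity
  have hρ₁pos : 0 < ρ₁ := lt_of_lt_of_le (by positivity) hρ₁lo
  have hinv : ρ₁⁻¹ ≤ K₁ * (1 + M) ^ K₁ := inv_le_of_inv_le₀ hKM₁ hρ₁lo
  have h4r1 : 4 * r ≤ 1 := by linarith
  have h4rγ : 4 * r ≤ (4 * r) ^ γ₃ (κ (b - a)) := by
    calc 4 * r = (4 * r) ^ (1 : ℝ) := (Real.rpow_one _).symm
      _ ≤ (4 * r) ^ γ₃ (κ (b - a)) := Real.rpow_le_rpow_of_exponent_ge (by positivity) h4r1 hγle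
  have hK₁le : K₁ ≤ K₁ * K₂ + K₁ + K₂ := by nlinarith
  have hK₁₂le : K₁ + K₂ ≤ K₁ * K₂ + K₁ + K₂ := by nlinarith
  by_cases hrρ : r ≤ ρ₁
  · -- scales below the threshold: the gauged law at scale ρ₁ with P = κ (b - a)
    have hconfρ : ∀ᵐ z ∂(volume.restrict (parabolicCylinder ρ₁ z₀)), swirl (u z.1) z.2 ∈ Icc a b :=
      ae_restrict_of_ae_restrict_of_subset (parabolicCylinder_subset_of_le hρ₁pos.le hρ₁hi z₀) hconf
    obtain ⟨a', b', ha'b', hconf', hdec⟩ :=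
      hL u p hsws haxi haxip M hM hA z₀ hz₀ hax (κ (b - a)) hP0 ρ₁ hρ₁pos hρ₁hi hPe a b hab hconfρ
        r hr hrρ
    refine ⟨a', b', ha'b', hconf', hdec.trans ?_⟩
    have h4ρ₁ : 4 * ρ₁ ≤ (4 * ρ₁) ^ γ₃ (κ (b - a)) := by
      calc 4 * ρ₁ = (4 * ρ₁) ^ (1 : ℝ) := (Real.rpow_one _).symm
        _ ≤ (4 * ρ₁) ^ γ₃ (κ (b - a)) :=
          Real.rpow_le_rpow_of_exponent_ge (by positivity) (by linarith) hγle
    have hsplit : (r / ρ₁) ^ γ₃ (κ (b - a)) * (4 * ρ₁) ^ γ₃ (κ (b - a)) = (4 * r) ^ γ₃ (κ (b - a)) := by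
      rw [← Real.mul_rpow (by positivity) (by positivity)]
      congr 1
      field_simp
    have hkey : (r / ρ₁) ^ γ₃ (κ (b - a)) * (4 * ρ₁) ≤ (4 * r) ^ γ₃ (κ (b - a)) := by
      calc (r / ρ₁) ^ γ₃ (κ (b - a)) * (4 * ρ₁)
          ≤ (r / ρ₁) ^ γ₃ (κ (b - a)) * (4 * ρ₁) ^ γ₃ (κ (b - a)) :=
            mul_le_mul_of_nonneg_left h4ρ₁ (Real.rpow_nonneg (by positivity) _)
        _ = (4 * r) ^ γ₃ (κ (b - a)) := hsplit
    have hratio : (r / ρ₁) ^ γ₃ (κ (b - a)) * 4 ≤ (4 * r) ^ γ₃ (κ (b - a)) * (K₁ * (1 + M) ^ K₁) := by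
      calc (r / ρ₁) ^ γ₃ (κ (b - a)) * 4
          = (r / ρ₁) ^ γ₃ (κ (b - a)) * (4 * ρ₁) * ρ₁⁻¹ := by field_simp
        _ ≤ (4 * r) ^ γ₃ (κ (b - a)) * ρ₁⁻¹ :=
            mul_le_mul_of_nonneg_right hkey (inv_nonneg.mpr hρ₁pos.le)
        _ ≤ (4 * r) ^ γ₃ (κ (b - a)) * (K₁ * (1 + M) ^ K₁) :=
            mul_le_mul_of_nonneg_left hinv (Real.rpow_nonneg (by positivity) _)
    calc K₂ * (1 + M) ^ K₂ * (r / ρ₁) ^ γ₃ (κ (b - a)) * (b - a)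
        = K₂ / 4 * (1 + M) ^ K₂ * ((r / ρ₁) ^ γ₃ (κ (b - a)) * 4) * (b - a) := by ring
      _ ≤ K₂ / 4 * (1 + M) ^ K₂ * ((4 * r) ^ γ₃ (κ (b - a)) * (K₁ * (1 + M) ^ K₁)) * (b - a) := by
          gcongr
      _ = K₁ * K₂ / 4 * ((1 + M) ^ K₁ * (1 + M) ^ K₂) * (4 * r) ^ γ₃ (κ (b - a)) * (b - a) := by ring
      _ = K₁ * K₂ / 4 * (1 + M) ^ (K₁ + K₂) * (4 * r) ^ γ₃ (κ (b - a)) * (b - a) := by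
          rw [Real.rpow_add (by positivity)]
      _ ≤ (K₁ * K₂ + K₁ + K₂) * (1 + M) ^ (K₁ * K₂ + K₁ + K₂) * (4 * r) ^ γ₃ (κ (b - a)) * (b - a) := by
          gcongr
          · nlinarith
  · -- scales above the threshold: no contraction claimed, the prefactor pays
    have hρ₁r : ρ₁ < r := lt_of_not_ge hrρ
    refine ⟨a, b, hab,
      ae_restrict_of_ae_restrict_of_subset (parabolicCylinder_subset_of_le hr.le hr4 z₀) hconf, ?_⟩
    have hone : 1 ≤ (K₁ * K₂ + K₁ + K₂) * (1 + M) ^ (K₁ * K₂ + K₁ + K₂) * (4 * r) ^ γ₃ (κ (b - a)) := by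
      have h1 : 1 ≤ ρ₁ * (K₁ * (1 + M) ^ K₁) := by
        have := mul_le_mul_of_nonneg_left hinv hρ₁pos.le
        rwa [mul_inv_cancel₀ hρ₁pos.ne'] at this
      have h2 : ρ₁ ≤ (4 * r) ^ γ₃ (κ (b - a)) := by linarith
      calc (1 : ℝ) ≤ ρ₁ * (K₁ * (1 + M) ^ K₁) := h1
        _ ≤ (4 * r) ^ γ₃ (κ (b - a)) * ((K₁ * K₂ + K₁ + K₂) * (1 + M) ^ (K₁ * K₂ + K₁ + K₂)) := by
            gcongr
        _ = (K₁ * K₂ + K₁ + K₂) * (1 + M) ^ (K₁ * K₂ + K₁ + K₂) * (4 * r) ^ γ₃ (κ (b - a)) := by ring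
    calc b - a = 1 * (b - a) := (one_mul _).symm
      _ ≤ (K₁ * K₂ + K₁ + K₂) * (1 + M) ^ (K₁ * K₂ + K₁ + K₂) * (4 * r) ^ γ₃ (κ (b - a)) * (b - a) :=
          mul_le_mul_of_nonneg_right hone hS0

/-- Corollary: the two rungs of ROUND-17 imply ROUND-16's rung `SwirlGaugedLaw` (hence, by the tree's
`SwirlGaugedTower` §3–§4, the POLYNOMIAL Ożański–Palasek bound at fixed swirl Reynolds number). -/
theorem swirlGaugedLaw_of_meridional {κ : ℝ → ℝ} (hκ : ∀ S : ℝ, 0 ≤ S → 0 ≤ κ S)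
    (hN : MeridionalSwirlLaw κ) (hL : MeridionalGaugedLaw) : SwirlGaugedLaw := by
  obtain ⟨γ₃, hγ, hlaw⟩ := hL
  exact ⟨fun S => γ₃ (κ S), fun S hS => (hγ (κ S) (hκ S hS)).1,
    swirlGaugedHolderLaw_of_meridional hκ hγ hN hlaw⟩

/-- ROUND-17's Navier–Stokes-essential rung with SOME nonnegative budget profile `κ`. -/
@[conjecture]
def MeridionalSwirlBudget : Prop :=
  ∃ κ : ℝ → ℝ, (∀ S : ℝ, 0 ≤ S → 0 ≤ κ S) ∧ MeridionalSwirlLaw κ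

/-- **ROUND-16's rung from ROUND-17's two rungs** (registered hypotheses only):
`MeridionalSwirlBudget → MeridionalGaugedLaw → SwirlGaugedLaw`. -/
theorem swirlGaugedLaw_of_rungs (hN : MeridionalSwirlBudget) (hL : MeridionalGaugedLaw) :
    SwirlGaugedLaw := by
  obtain ⟨κ, hκ, hNκ⟩ := hN
  exact swirlGaugedLaw_of_meridional hκ hNκ hL

/-- The Arrhenius profile is an admissible rate: `ArrheniusMeridionalLaw → MeridionalGaugedLaw`. -/
theorem ArrheniusMeridionalLaw.meridionalGaugedLaw (h : ArrheniusMeridionalLaw) :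
    MeridionalGaugedLaw := by
  obtain ⟨C, hC, hlaw⟩ := h
  refine ⟨fun P => Real.exp (-(C * (1 + P))), fun P hP => ⟨Real.exp_pos _, ?_⟩, hlaw⟩
  rw [Real.exp_le_one_iff]
  nlinarith

/-- With MERIDIONAL CIRCULATION NEEDS SWIRL at a LINEAR profile `κ S = k(1+S)` and the Arrhenius rate,
the swirl-gauged profile is `exp(-C(1 + k(1+S)))` — ROUND-16's predicted `ExpSwirlGaugedLaw 1` shape
up to constants (the η-budget's `e^{-0.35 S}`). -/
theorem expSwirlProfile_of_linear_budget {C k : ℝ} (hC : 0 < C) (hk : 0 ≤ k)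
    (hN : MeridionalSwirlLaw (fun S => k * (1 + S)))
    (hL : MeridionalGaugedHolderLaw (fun P => Real.exp (-(C * (1 + P))))) :
    SwirlGaugedHolderLaw (fun S => Real.exp (-(C * (1 + k * (1 + S))))) := by
  have hκ : ∀ S : ℝ, 0 ≤ S → 0 ≤ k * (1 + S) := fun S hS => by positivity
  have hγ : ∀ P : ℝ, 0 ≤ P → 0 < Real.exp (-(C * (1 + P))) ∧ Real.exp (-(C * (1 + P))) ≤ 1 :=
    fun P hP => ⟨Real.exp_pos _, by rw [Real.exp_le_one_iff]; nlinarith⟩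
  exact swirlGaugedHolderLaw_of_meridional (κ := fun S => k * (1 + S))
    (γ₃ := fun P => Real.exp (-(C * (1 + P)))) hκ hγ hN hL

end

end Summit.NavierStokesRegularity.NavierStokesRegularity.Theorems.MeridionalBarrier
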